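import Summits.AnomalousDissipation.AnomalousDissipation.Theorems.TaylorCertificatesKolmogorovFloorResponseDefs

/-!
# FRAME: the balanced-digit frame (negative side of `TaylorCertificates.KolmogorovFloor`)

Crux stmt-AnomalousDissipation-15122, line `digit-frame-closure` (stub FRAME of the line skeleton); finite integer
arithmetic about the objects fixed in `TaylorCertificatesKolmogorovFloorResponseDefs` (companion file: `...Det`).

`digitFrame`. In the balanced-digit frame of level `L ≥ 1`, `B = 2L+1`, `e = (1, B, B²)`, `ξ = (B, B³−1, −B²)`,
`n = ξ × e`: `ξ ⊥ e`, the sizes `B⁶ ≤ ξ·ξ ≤ 3B⁶`, `B⁴ ≤ e·e ≤ 3B⁴`, `n·n = (ξ·ξ)(e·e)`, and for every nonzero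
lattice mode `k` with `k·k ≤ L²` (so `|kᵢ| ≤ L < B/2`, i.e. the `kᵢ` are balanced base-`B` digits):
non-resonance `k·k < 2|k·ξ|`, admissibility `k·e ≠ 0 ≠ k·n`, and the angle condition `9(k·k)² ≤ 4|k × ξ|²`
(Lagrange: `|k × ξ|² = (k·k)(ξ·ξ) − (k·ξ)²`). Each is "the leading nonzero digit dominates": a case analysis on
which component of `k` is nonzero, the triangle inequality, and a polynomial inequality in `L`.
-/

noncomputable section

set_option linter.dupNamespace false

open Matrix Finset
open scoped BigOperators

namespace Summit.AnomalousDissipation.AnomalousDissipation.Theorems.KolmogorovFloor.Response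

/-! ### Integer arithmetic of the digit frame -/

/-- Triangle inequality in the form `|x| − |y| − |z| ≤ |x + y + z|`. -/
private lemma abs_add_three_ge (x y z : ℤ) : |x| - |y| - |z| ≤ |x + y + z| := by
  have h1 := le_abs_self (x + y + z)
  have h2 := neg_le_abs (x + y + z)
  have h3 := le_abs_self y
  have h4 := neg_le_abs y
  have h5 := le_abs_self z
  have h6 := neg_le_abs z
  have h7 : |x| ≤ |x + y + z| + |y| + |z| := by
    rw [abs_le']
    constructor <;> linarith
  linarith

/-- From `k·k ≤ L²`: every component of `k` is at most `L` in absolute value. -/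
private lemma comp_abs_le {L : ℕ} {k0 k1 k2 : ℤ} (h : k0 * k0 + k1 * k1 + k2 * k2 ≤ (L : ℤ) ^ 2) :
    |k0| ≤ L ∧ |k1| ≤ L ∧ |k2| ≤ L := by
  have hL : (0 : ℤ) ≤ L := by positivity
  refine ⟨abs_le_of_sq_le_sq (by nlinarith [mul_self_nonneg k1, mul_self_nonneg k2]) hL,
    abs_le_of_sq_le_sq (by nlinarith [mul_self_nonneg k0, mul_self_nonneg k2]) hL,
    abs_le_of_sq_le_sq (by nlinarith [mul_self_nonneg k0, mul_self_nonneg k1]) hL⟩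

/-- `|k P| ≤ L P` for `|k| ≤ L`, `P ≥ 0`. -/
private lemma abs_mul_le_of {k P L : ℤ} (hk : |k| ≤ L) (hP : 0 ≤ P) : |k * P| ≤ L * P := by
  rw [abs_mul, abs_of_nonneg hP]
  exact mul_le_mul_of_nonneg_right hk hP

/-- `P ≤ |k P|` for `k ≠ 0`, `P ≥ 0`. -/
private lemma le_abs_mul_of {k P : ℤ} (hk : k ≠ 0) (hP : 0 ≤ P) : P ≤ |k * P| := by
  rw [abs_mul, abs_of_nonneg hP]
  exact le_mul_of_one_le_left hP (Int.one_le_abs hk)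

/-- Squaring step: `3K ≤ 2|C|` with `K ≥ 0` gives `9K² ≤ 4C²`. -/
private lemma nine_sq_le {K C : ℤ} (hK : 0 ≤ K) (h : 3 * K ≤ 2 * |C|) : 9 * K ^ 2 ≤ 4 * C ^ 2 := by
  have := mul_le_mul h h (by positivity) (by positivity)
  nlinarith [abs_mul_abs_self C]

/-- The three frame sizes: `B⁶ ≤ ξ·ξ ≤ 3B⁶`, `B⁴ ≤ e·e ≤ 3B⁴` (`B ≥ 1` suffices). -/
private lemma frame_sizes (L : ℕ) (B : ℤ) (hB : B = 2 * (L : ℤ) + 1) :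
    B ^ 6 ≤ B ^ 2 + (B ^ 3 - 1) ^ 2 + B ^ 4 ∧ B ^ 2 + (B ^ 3 - 1) ^ 2 + B ^ 4 ≤ 3 * B ^ 6 ∧
    B ^ 4 ≤ 1 + B ^ 2 + B ^ 4 ∧ 1 + B ^ 2 + B ^ 4 ≤ 3 * B ^ 4 := by
  have hL0 : (0 : ℤ) ≤ L := by positivity
  have hB1 : 1 ≤ B := by linarith
  have h26 : B ^ 2 ≤ B ^ 6 := pow_le_pow_right₀ hB1 (by norm_num)
  have h46 : B ^ 4 ≤ B ^ 6 := pow_le_pow_right₀ hB1 (by norm_num)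
  have h24 : B ^ 2 ≤ B ^ 4 := pow_le_pow_right₀ hB1 (by norm_num)
  have h3 : 1 ≤ B ^ 3 := one_le_pow₀ hB1
  have h4 : 1 ≤ B ^ 4 := one_le_pow₀ hB1
  have hsq : 0 ≤ (B * (B - 1)) ^ 2 := sq_nonneg _
  have hB2 : 0 ≤ B ^ 2 := by positivity
  refine ⟨by nlinarith, by nlinarith, by nlinarith, by nlinarith⟩

/-- Non-resonance `k·k < 2|k·ξ|` in digit coordinates. -/
private lemma frame_nonres (L : ℕ) (hL : 1 ≤ L) (B k0 k1 k2 : ℤ) (hB : B = 2 * (L : ℤ) + 1)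
    (hk : ¬ (k0 = 0 ∧ k1 = 0 ∧ k2 = 0)) (hkL : k0 * k0 + k1 * k1 + k2 * k2 ≤ (L : ℤ) ^ 2) :
    k0 * k0 + k1 * k1 + k2 * k2 < 2 * |k0 * B + k1 * (B ^ 3 - 1) - k2 * B ^ 2| := by
  obtain ⟨h0, h1, h2⟩ := comp_abs_le hkL
  have hL1 : (1 : ℤ) ≤ L := by exact_mod_cast hL
  have hL0 : (0 : ℤ) < L := by linarith
  have hB0 : 0 ≤ B := by rw [hB]; positivity
  have hB2 : 0 ≤ B ^ 2 := by positivity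
  have hB31 : 0 ≤ B ^ 3 - 1 := by rw [hB]; nlinarith [pow_pos hL0 3, pow_pos hL0 2]
  by_cases hk1 : k1 = 0
  · by_cases hk2 : k2 = 0
    · -- `k = (k0, 0, 0)` with `k0 ≠ 0`
      have hk0 : k0 ≠ 0 := fun h => hk ⟨h, hk1, hk2⟩
      subst hk1
      subst hk2
      have hpos : 0 < |k0| := abs_pos.2 hk0
      have e : k0 * B + 0 * (B ^ 3 - 1) - 0 * B ^ 2 = k0 * B := by ring
      rw [e, abs_mul, abs_of_nonneg hB0]
      have hlt : |k0| < 2 * B := by rw [hB]; linarith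
      nlinarith [mul_pos hpos (sub_pos.2 hlt), abs_mul_abs_self k0]
    · -- `k1 = 0`, `k2 ≠ 0`: the digit `k2 B²` dominates
      subst hk1
      have e : k0 * B + 0 * (B ^ 3 - 1) - k2 * B ^ 2 = k2 * (-(B ^ 2)) + k0 * B + 0 := by ring
      rw [e]
      have t := abs_add_three_ge (k2 * (-(B ^ 2))) (k0 * B) 0
      have u1 : B ^ 2 ≤ |k2 * (-(B ^ 2))| := by
        rw [mul_neg, abs_neg]; exact le_abs_mul_of hk2 hB2
      have u2 : |k0 * B| ≤ L * B := abs_mul_le_of h0 hB0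
      have poly : (L : ℤ) ^ 2 < 2 * (B ^ 2 - L * B) := by rw [hB]; nlinarith
      simp only [abs_zero, sub_zero] at t
      nlinarith [mul_self_nonneg k0, mul_self_nonneg k2]
  · -- `k1 ≠ 0`: the digit `k1 (B³ - 1)` dominates
    have e : k0 * B + k1 * (B ^ 3 - 1) - k2 * B ^ 2 = k1 * (B ^ 3 - 1) + k0 * B + k2 * (-(B ^ 2)) := by
      ring
    rw [e]
    have t := abs_add_three_ge (k1 * (B ^ 3 - 1)) (k0 * B) (k2 * (-(B ^ 2)))
    have u1 : B ^ 3 - 1 ≤ |k1 * (B ^ 3 - 1)| := le_abs_mul_of hk1 hB31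
    have u2 : |k0 * B| ≤ L * B := abs_mul_le_of h0 hB0
    have u3 : |k2 * (-(B ^ 2))| ≤ L * B ^ 2 := by
      rw [mul_neg, abs_neg]; exact abs_mul_le_of h2 hB2
    have poly : (L : ℤ) ^ 2 < 2 * (B ^ 3 - 1 - L * B - L * B ^ 2) := by
      rw [hB]; nlinarith [pow_pos hL0 3, pow_pos hL0 2]
    linarith

/-- Admissibility `k·e ≠ 0` in digit coordinates (balanced base-`B` numerals are faithful). -/
private lemma frame_adm_e (L : ℕ) (hL : 1 ≤ L) (B k0 k1 k2 : ℤ) (hB : B = 2 * (L : ℤ) + 1)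
    (hk : ¬ (k0 = 0 ∧ k1 = 0 ∧ k2 = 0)) (hkL : k0 * k0 + k1 * k1 + k2 * k2 ≤ (L : ℤ) ^ 2) :
    k0 + k1 * B + k2 * B ^ 2 ≠ 0 := by
  obtain ⟨h0, h1, h2⟩ := comp_abs_le hkL
  have hL1 : (1 : ℤ) ≤ L := by exact_mod_cast hL
  have hB0 : 0 ≤ B := by rw [hB]; positivity
  have hB2 : 0 ≤ B ^ 2 := by positivity
  intro hzero
  by_cases hk2 : k2 = 0
  · by_cases hk1 : k1 = 0
    · refine hk ⟨?_, hk1, hk2⟩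
      rw [hk1, hk2] at hzero
      simpa using hzero
    · -- `k2 = 0`, `k1 ≠ 0`: `|k1 B + k0| ≥ B - L > 0`
      have t := abs_add_three_ge (k1 * B) k0 0
      have u1 : B ≤ |k1 * B| := le_abs_mul_of hk1 hB0
      have e : k1 * B + k0 + 0 = 0 := by rw [hk2] at hzero; linear_combination hzero
      rw [e] at t
      simp only [abs_zero, sub_zero] at t
      have : 0 < B - L := by rw [hB]; linarith
      linarith
  · -- `k2 ≠ 0`: `|k2 B² + k1 B + k0| ≥ B² - L B - L > 0`
    have t := abs_add_three_ge (k2 * B ^ 2) (k1 * B) k0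
    have u1 : B ^ 2 ≤ |k2 * B ^ 2| := le_abs_mul_of hk2 hB2
    have u2 : |k1 * B| ≤ L * B := abs_mul_le_of h1 hB0
    have e : k2 * B ^ 2 + k1 * B + k0 = 0 := by linear_combination hzero
    rw [e] at t
    simp only [abs_zero] at t
    have : 0 < B ^ 2 - L * B - L := by rw [hB]; nlinarith
    linarith

/-- Admissibility `k·n ≠ 0` in digit coordinates, `n = ξ × e = (B⁵+B³−B², −(B³+B²), −(B³−B²−1))`. -/
private lemma frame_adm_n (L : ℕ) (hL : 1 ≤ L) (B k0 k1 k2 : ℤ) (hB : B = 2 * (L : ℤ) + 1)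
    (hk : ¬ (k0 = 0 ∧ k1 = 0 ∧ k2 = 0)) (hkL : k0 * k0 + k1 * k1 + k2 * k2 ≤ (L : ℤ) ^ 2) :
    k0 * (B ^ 5 + B ^ 3 - B ^ 2) - k1 * (B ^ 3 + B ^ 2) - k2 * (B ^ 3 - B ^ 2 - 1) ≠ 0 := by
  obtain ⟨h0, h1, h2⟩ := comp_abs_le hkL
  have hL1 : (1 : ℤ) ≤ L := by exact_mod_cast hL
  have hL0 : (0 : ℤ) < L := by linarith
  have hB0 : 0 ≤ B := by rw [hB]; positivity
  have hB1 : 1 ≤ B := by linarith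
  have hB2 : 0 ≤ B ^ 2 := by positivity
  have hB3 : 0 ≤ B ^ 3 := by positivity
  have hP1 : 0 ≤ B ^ 5 + B ^ 3 - B ^ 2 := by
    have : B ^ 2 ≤ B ^ 5 := pow_le_pow_right₀ hB1 (by norm_num)
    linarith
  have hP2 : 0 ≤ B ^ 3 + B ^ 2 := by positivity
  have hP3 : 0 ≤ B ^ 3 - B ^ 2 - 1 := by rw [hB]; nlinarith [pow_pos hL0 3, pow_pos hL0 2]
  intro hzero
  by_cases hk0 : k0 = 0
  · subst hk0
    by_cases hs : k1 + k2 = 0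
    · -- `k = (0, -k2, k2)`: `k·n = k2 (2B² + 1)`
      have hk1 : k1 = -k2 := by linarith
      have hk2 : k2 ≠ 0 := by
        rintro rfl
        exact hk ⟨rfl, by linarith, rfl⟩
      have e : 0 * (B ^ 5 + B ^ 3 - B ^ 2) - k1 * (B ^ 3 + B ^ 2) - k2 * (B ^ 3 - B ^ 2 - 1) =
          k2 * (2 * B ^ 2 + 1) := by
        rw [hk1]; ring
      rw [e] at hzero
      have hne : (2 * B ^ 2 + 1) ≠ 0 := by positivity
      exact mul_ne_zero hk2 hne hzero
    · -- `k0 = 0`, `k1 + k2 ≠ 0`: the digit `(k1 + k2) B³` dominates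
      have e : 0 * (B ^ 5 + B ^ 3 - B ^ 2) - k1 * (B ^ 3 + B ^ 2) - k2 * (B ^ 3 - B ^ 2 - 1) =
          (-(k1 + k2)) * B ^ 3 + (k2 - k1) * B ^ 2 + k2 := by
        ring
      rw [e] at hzero
      have t := abs_add_three_ge ((-(k1 + k2)) * B ^ 3) ((k2 - k1) * B ^ 2) k2
      have u1 : B ^ 3 ≤ |(-(k1 + k2)) * B ^ 3| := le_abs_mul_of (neg_ne_zero.2 hs) hB3
      have hk12 : |k2 - k1| ≤ 2 * L := by
        obtain ⟨a1, a2⟩ := abs_le.1 h1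
        obtain ⟨b1, b2⟩ := abs_le.1 h2
        exact abs_le.2 ⟨by linarith, by linarith⟩
      have u2 : |(k2 - k1) * B ^ 2| ≤ 2 * L * B ^ 2 := abs_mul_le_of hk12 hB2
      rw [hzero, abs_zero] at t
      have : 0 < B ^ 3 - 2 * L * B ^ 2 - L := by rw [hB]; nlinarith [pow_pos hL0 3, pow_pos hL0 2]
      linarith
  · -- `k0 ≠ 0`: the digit `k0 (B⁵ + B³ - B²)` dominates
    have t := abs_add_three_ge (k0 * (B ^ 5 + B ^ 3 - B ^ 2)) (-(k1 * (B ^ 3 + B ^ 2)))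
      (-(k2 * (B ^ 3 - B ^ 2 - 1)))
    have e : k0 * (B ^ 5 + B ^ 3 - B ^ 2) + -(k1 * (B ^ 3 + B ^ 2)) + -(k2 * (B ^ 3 - B ^ 2 - 1)) = 0 := by
      linear_combination hzero
    rw [e, abs_zero, abs_neg, abs_neg] at t
    have u1 : B ^ 5 + B ^ 3 - B ^ 2 ≤ |k0 * (B ^ 5 + B ^ 3 - B ^ 2)| := le_abs_mul_of hk0 hP1
    have u2 : |k1 * (B ^ 3 + B ^ 2)| ≤ L * (B ^ 3 + B ^ 2) := abs_mul_le_of h1 hP2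
    have u3 : |k2 * (B ^ 3 - B ^ 2 - 1)| ≤ L * (B ^ 3 - B ^ 2 - 1) := abs_mul_le_of h2 hP3
    have : 0 < B ^ 5 + B ^ 3 - B ^ 2 - L * (B ^ 3 + B ^ 2) - L * (B ^ 3 - B ^ 2 - 1) := by
      rw [hB]; nlinarith [pow_pos hL0 5, pow_pos hL0 4, pow_pos hL0 3, pow_pos hL0 2]
    linarith

/-- The angle condition `9(k·k)² ≤ 4|k × ξ|²` in digit coordinates,
`k × ξ = (−k1 B² − k2 (B³−1), k2 B + k0 B², k0 (B³−1) − k1 B)`. -/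
private lemma frame_cross (L : ℕ) (hL : 1 ≤ L) (B k0 k1 k2 : ℤ) (hB : B = 2 * (L : ℤ) + 1)
    (hk : ¬ (k0 = 0 ∧ k1 = 0 ∧ k2 = 0)) (hkL : k0 * k0 + k1 * k1 + k2 * k2 ≤ (L : ℤ) ^ 2) :
    9 * (k0 * k0 + k1 * k1 + k2 * k2) ^ 2 ≤
      4 * ((k1 * B ^ 2 + k2 * (B ^ 3 - 1)) ^ 2 + (k2 * B + k0 * B ^ 2) ^ 2 +
        (k0 * (B ^ 3 - 1) - k1 * B) ^ 2) := by
  obtain ⟨h0, h1, h2⟩ := comp_abs_le hkL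
  have hL1 : (1 : ℤ) ≤ L := by exact_mod_cast hL
  have hL0 : (0 : ℤ) < L := by linarith
  have hB0 : 0 ≤ B := by rw [hB]; positivity
  have hB2 : 0 ≤ B ^ 2 := by positivity
  have hB31 : 0 ≤ B ^ 3 - 1 := by rw [hB]; nlinarith [pow_pos hL0 3, pow_pos hL0 2]
  have hK0 : 0 ≤ k0 * k0 + k1 * k1 + k2 * k2 :=
    add_nonneg (add_nonneg (mul_self_nonneg _) (mul_self_nonneg _)) (mul_self_nonneg _)
  have sq0 := sq_nonneg (k1 * B ^ 2 + k2 * (B ^ 3 - 1))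
  have sq1 := sq_nonneg (k2 * B + k0 * B ^ 2)
  have sq2 := sq_nonneg (k0 * (B ^ 3 - 1) - k1 * B)
  by_cases hk2 : k2 = 0
  · by_cases hk0 : k0 = 0
    · -- `k = (0, k1, 0)`: first component `k1 B²`, `k·k = k1²`
      have hk1 : k1 ≠ 0 := fun h => hk ⟨hk0, h, hk2⟩
      subst hk2
      subst hk0
      have hK : 3 * (0 * 0 + k1 * k1 + 0 * 0) ≤ 2 * |k1 * B ^ 2 + 0 * (B ^ 3 - 1)| := by
        rw [show k1 * B ^ 2 + 0 * (B ^ 3 - 1) = k1 * B ^ 2 by ring, abs_mul, abs_of_nonneg hB2]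
        have h3 : 3 * |k1| ≤ 2 * B ^ 2 := by rw [hB]; nlinarith [abs_nonneg k1]
        nlinarith [mul_le_mul_of_nonneg_left h3 (abs_nonneg k1), abs_mul_abs_self k1]
      have := nine_sq_le hK0 hK
      linarith
    · -- `k2 = 0`, `k0 ≠ 0`: third component `k0 (B³ - 1) - k1 B`
      have t := abs_add_three_ge (k0 * (B ^ 3 - 1)) (-(k1 * B)) 0
      have e : k0 * (B ^ 3 - 1) + -(k1 * B) + 0 = k0 * (B ^ 3 - 1) - k1 * B := by ring
      rw [e] at t
      simp only [abs_neg, abs_zero, sub_zero] at t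
      have u1 : B ^ 3 - 1 ≤ |k0 * (B ^ 3 - 1)| := le_abs_mul_of hk0 hB31
      have u2 : |k1 * B| ≤ L * B := abs_mul_le_of h1 hB0
      have poly : 3 * (L : ℤ) ^ 2 ≤ 2 * (B ^ 3 - 1 - L * B) := by
        rw [hB]; nlinarith [pow_pos hL0 3, pow_pos hL0 2]
      have hK : 3 * (k0 * k0 + k1 * k1 + k2 * k2) ≤ 2 * |k0 * (B ^ 3 - 1) - k1 * B| := by linarith
      have := nine_sq_le hK0 hK
      linarith
  · -- `k2 ≠ 0`: first component `k1 B² + k2 (B³ - 1)`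
    have t := abs_add_three_ge (k2 * (B ^ 3 - 1)) (k1 * B ^ 2) 0
    have e : k2 * (B ^ 3 - 1) + k1 * B ^ 2 + 0 = k1 * B ^ 2 + k2 * (B ^ 3 - 1) := by ring
    rw [e] at t
    simp only [abs_zero, sub_zero] at t
    have u1 : B ^ 3 - 1 ≤ |k2 * (B ^ 3 - 1)| := le_abs_mul_of hk2 hB31
    have u2 : |k1 * B ^ 2| ≤ L * B ^ 2 := abs_mul_le_of h1 hB2
    have poly : 3 * (L : ℤ) ^ 2 ≤ 2 * (B ^ 3 - 1 - L * B ^ 2) := by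
      rw [hB]; nlinarith [pow_pos hL0 3, pow_pos hL0 2]
    have hK : 3 * (k0 * k0 + k1 * k1 + k2 * k2) ≤ 2 * |k1 * B ^ 2 + k2 * (B ^ 3 - 1)| := by linarith
    have := nine_sq_le hK0 hK
    linarith

/-- **FRAME (digit frame of level `L`).** `ξ_L ⊥ e_L`; the sizes `B⁶ ≤ ξ·ξ ≤ 3B⁶`, `B⁴ ≤ e·e ≤ 3B⁴`,
`n·n = (ξ·ξ)(e·e)`; and for every nonzero lattice mode of the `L`-ball: non-resonance `k·k < 2|k·ξ_L|`, the two
admissibility planes `k·e_L ≠ 0 ≠ k·n_L`, and `9(k·k)² ≤ 4|k × ξ_L|²`. -/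
theorem digitFrame : ∀ L : ℕ, 1 ≤ L →
    digitXi L ⬝ᵥ digitE L = 0 ∧
    (2 * (L : ℤ) + 1) ^ 6 ≤ digitXi L ⬝ᵥ digitXi L ∧ digitXi L ⬝ᵥ digitXi L ≤ 3 * (2 * (L : ℤ) + 1) ^ 6 ∧
    (2 * (L : ℤ) + 1) ^ 4 ≤ digitE L ⬝ᵥ digitE L ∧ digitE L ⬝ᵥ digitE L ≤ 3 * (2 * (L : ℤ) + 1) ^ 4 ∧
    digitN L ⬝ᵥ digitN L = (digitXi L ⬝ᵥ digitXi L) * (digitE L ⬝ᵥ digitE L) ∧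
    ∀ k : Fin 3 → ℤ, k ≠ 0 → k ⬝ᵥ k ≤ (L : ℤ) ^ 2 →
      k ⬝ᵥ k < 2 * |k ⬝ᵥ digitXi L| ∧ k ⬝ᵥ digitE L ≠ 0 ∧ k ⬝ᵥ digitN L ≠ 0 ∧
      9 * (k ⬝ᵥ k) ^ 2 ≤ 4 * ((k ⬝ᵥ k) * (digitXi L ⬝ᵥ digitXi L) - (k ⬝ᵥ digitXi L) ^ 2) := by
  intro L hL
  have hB : digitB L = 2 * (L : ℤ) + 1 := rfl
  have hxe : digitXi L ⬝ᵥ digitE L = 0 := digitXi_dotProduct_digitE L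
  have hxx : digitXi L ⬝ᵥ digitXi L = digitB L ^ 2 + (digitB L ^ 3 - 1) ^ 2 + digitB L ^ 4 := by
    simp [dotProduct, Fin.sum_univ_three, digitXi]
    ring
  have hee : digitE L ⬝ᵥ digitE L = 1 + digitB L ^ 2 + digitB L ^ 4 := by
    simp [dotProduct, Fin.sum_univ_three, digitE]
    ring
  have hnn : digitN L ⬝ᵥ digitN L = (digitXi L ⬝ᵥ digitXi L) * (digitE L ⬝ᵥ digitE L) := by
    rw [digitN, cross3_dotProduct_self, hxe]
    ring
  obtain ⟨s1, s2, s3, s4⟩ := frame_sizes L (digitB L) hB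
  rw [← hB]
  refine ⟨hxe, by rw [hxx]; exact s1, by rw [hxx]; exact s2, by rw [hee]; exact s3, by rw [hee]; exact s4,
    hnn, ?_⟩
  intro k hk hkL
  have hkk : k ⬝ᵥ k = k 0 * k 0 + k 1 * k 1 + k 2 * k 2 := by
    simp [dotProduct, Fin.sum_univ_three]
  have hkxi : k ⬝ᵥ digitXi L = k 0 * digitB L + k 1 * (digitB L ^ 3 - 1) - k 2 * digitB L ^ 2 := by
    simp [dotProduct, Fin.sum_univ_three, digitXi]
    ring
  have hke : k ⬝ᵥ digitE L = k 0 + k 1 * digitB L + k 2 * digitB L ^ 2 := by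
    simp [dotProduct, Fin.sum_univ_three, digitE]
  have hkn : k ⬝ᵥ digitN L = k 0 * (digitB L ^ 5 + digitB L ^ 3 - digitB L ^ 2) -
      k 1 * (digitB L ^ 3 + digitB L ^ 2) - k 2 * (digitB L ^ 3 - digitB L ^ 2 - 1) := by
    simp [dotProduct, Fin.sum_univ_three, digitN, cross3, digitXi, digitE]
    ring
  have hlag : (k ⬝ᵥ k) * (digitXi L ⬝ᵥ digitXi L) - (k ⬝ᵥ digitXi L) ^ 2 =
      (k 1 * digitB L ^ 2 + k 2 * (digitB L ^ 3 - 1)) ^ 2 + (k 2 * digitB L + k 0 * digitB L ^ 2) ^ 2 +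
        (k 0 * (digitB L ^ 3 - 1) - k 1 * digitB L) ^ 2 := by
    rw [hkk, hxx, hkxi]
    ring
  have hk' : ¬ (k 0 = 0 ∧ k 1 = 0 ∧ k 2 = 0) := by
    rintro ⟨h0, h1, h2⟩
    apply hk
    ext i
    fin_cases i <;> simp [h0, h1, h2]
  rw [hkk] at hkL
  rw [hlag, hkxi, hke, hkn, hkk]
  exact ⟨frame_nonres L hL _ _ _ _ hB hk' hkL, frame_adm_e L hL _ _ _ _ hB hk' hkL,
    frame_adm_n L hL _ _ _ _ hB hk' hkL, frame_cross L hL _ _ _ _ hB hk' hkL⟩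

end Summit.AnomalousDissipation.AnomalousDissipation.Theorems.KolmogorovFloor.Response
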